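import Literature.NumberTheory.EllipticCurves.BigRepModuleShiftStructureProofs
import Literature.NumberTheory.EllipticCurves.BigRepModuleShapiroInjectiveProofs
import Literature.NumberTheory.EllipticCurves.CharIdealDualLocalizationStepProofs
import Literature.NumberTheory.EllipticCurves.IwasawaAlgebraCompactNakayamaProofs
import Literature.NumberTheory.EllipticCurves.IwasawaAlgebraRankOneIdealProofs
import Literature.NumberTheory.EllipticCurves.IwasawaAlgebraPseudoNullProofs
import Literature.NumberTheory.EllipticCurves.SkinnerUrban2014.CofinitelyGeneratedSelmerProofs
import Mathlib.Topology.Instances.AddCircle.Defs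
import HarnessLib

/-!
# The Pontryagin dual of `H ⊗ Λ^*` for a FINITE `p`-primary `H`: a finitely generated torsion
# `Λ = ℤ_p⟦T⟧`-module whose characteristic ideal contains `#H` — PROVED

Topic `Literature/NumberTheory/EllipticCurves` (namespace = path + `BigRepModule`). THEOREMS ONLY: no
definition, no named fact, no instance, no `sorry`. Cell `bsd-stepL` (typer lane `defn-ty1`, g9),
module L1 of the discharge plan `HOME/defn-ty1/g9/NOTE-sigmaLocal-discharge-plan-defn-ty1-g9.md` for
the named LOCAL fact `JetchevSkinnerWan2017.sigmaLocal_charIdeal_eulerFactor_mem_of_noTamagawaDefect`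
(the local term of the `Σ`-change at a place `w ∤ p`): its TOTALLY SPLIT case (`Ψ(Frob_w) = 1`) is,
after Shapiro, the statement proved here applied to `H = H¹(K_w, E[p^∞])`.

## The printed statement

[PollackWeston2011] Lemma 3.2 (arXiv:math/0610694 p. 7): "If `ℓ` is inert or ramified in `K/ℚ`, then
`ℓ` splits completely in `K_∞` and `ℋ_ℓ = H¹(K_ℓ, A_f) ⊗ Λ^∨` where `Λ^∨ = Hom_𝒪(Λ, F/𝒪)`";
[Castella2018] Thm. 2.3 (2.7) (arXiv:1704.06608 p. 5): the factor "`∏_{w∈Σ} #H¹(K_w, E[p^∞])`" —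
the characteristic ideal of the Pontryagin dual `(H ⊗ Λ^∨)^∨ ≅ H^∨ ⊗_{ℤ_p} Λ ≅ ⊕ Λ/p^{a_i}` of
`H ⊗ Λ^∨` for a finite `H ≅ ⊕ ℤ/p^{a_i}` is `(∏ p^{a_i}) = (#H)`.

## What is proved (tree's co-induced model `BigRepModule ℤ_[p] p H` = smooth `p`-primary functions
## `ℤ_p → H`, `T` acting as `τ₁ − 1`; Pontryagin dual = Mathlib `CharacterModule`, `(f·χ)(Φ) = χ(f·Φ)`)

For a FINITE `ℤ_p`-module `H` all of whose elements are `p`-power torsion, with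
`L(H) = BigRepModule ℤ_[p] p H` and `X(H) = CharacterModule (L(H))`:
* `exact_mapRangeₗ_of_injective`, `mapRange_surjective_of_surjective` — `H ↦ L(H)` is exact
  (§1, any coefficient ring `𝒪`);
* `characterModule_separated` — `X(H)` is `(p, T)`-separated; `finite_torsionBy_X` — `L(H)[T]` (the
  constant functions, `X_smul_eq_zero_iff`) is finite; `module_finite_characterModule` — `X(H)` is a
  finitely generated `Λ`-module (compact Nakayama in separated form,
  `module_finite_of_separated_of_forall_exists_sub_X_smul_mem_span`, with `X/TX ↪ (L[T])^∨`);
  `isTorsion_characterModule` — `X(H)` is `Λ`-torsion (killed by `p^k`);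
* `exists_span_singleton_eq_top_of_card_eq_prime`, `natCast_prime_mem_charIdeal_of_card_eq_prime` —
  for `#H = p`: `X(H)` is CYCLIC, a quotient of `Λ/(p)`, so `(p) ⊆ Ch(X(H))`
  (`charIdeal_quotient_span_singleton`, multiplicativity); the one external input is that the
  `p`-torsion of `ℚ/ℤ` is generated by any of its non-zero elements
  (`AddCircle.mem_zmultiples_of_prime_nsmul_eq_zero`);
* **`natCard_mem_charIdeal_characterModule`** — `(Nat.card H : Λ) ∈ Ch_Λ(X(H))`, by induction on
  `#H` along `0 → L(ℤ_p h) → L(H) → L(H/ℤ_p h)` (`p h = 0`, `h ≠ 0`) with the tree's one-step lemma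
  `Module.isTorsion_and_charIdeal_mul_span_le_of_exact_dual`;
* `moduleFinite_isTorsion_natCard_mem_charIdeal` — the three conjuncts packaged in the shape of the
  local fact.

HONEST FRAMING: pure `Λ`-module algebra of the co-induced module with finite coefficients; nothing about
Galois cohomology, elliptic curves or BSD is proved here, and the named fact is NOT discharged by this
file (modules L2–L6 of the plan remain).

References: [PollackWeston2011] Lemma 3.2; [Castella2018] Thm. 2.3 (2.7), Prop. 2.5;
[GreenbergLNM1716] §4 (Props. 4.9–4.10: `𝒜[θ]`, Nakayama for Pontryagin duals); [Washington1997]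
Lemma 13.16, §13.2. Tree: `AnticyclotomicBigGaloisRep.lean` (`BigRepModule`, `mapRange`),
`BigRepModuleShiftStructureProofs.lean` (constants, torsion), `IwasawaAlgebraCompactNakayamaProofs.lean`,
`IwasawaAlgebraRankOneIdealProofs.lean` (`charIdeal_quotient_span_singleton`),
`CharIdealDualLocalizationStepProofs.lean` (imc-p1 g12), `SkinnerUrban2014/CofinitelyGeneratedSelmerProofs.lean`
(`finite_characterModule`, `exists_smul_eq_of_forall_apply_eq_zero`).
-/

noncomputable section

open Literature.NumberTheory.EllipticCurves

namespace Literature.NumberTheory.EllipticCurves.BigRepModule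

universe u

/-! ## §1 Exactness of `A ↦ A ⊗ Λ^*` (any coefficient ring) -/

section Exactness

variable {𝒪 : Type*} [CommRing 𝒪] {p : ℕ} [Fact p.Prime]
variable {A A' A'' : Type*} [AddCommGroup A] [Module 𝒪 A] [AddCommGroup A'] [Module 𝒪 A']
  [AddCommGroup A''] [Module 𝒪 A'']

/-- A smooth function `ℤ_p → A` has FINITE range (it factors through `ℤ/pⁿ`).
[cite: SkinnerUrban2014, §3.1.3 and proof of Prop. 3.2.3 (Λ^* = lim Hom(ℤ[Gal(F_n/F)], ·))] -/
theorem finite_range (Φ : BigRepModule 𝒪 p A) : (Set.range (Φ : ℤ_[p] → A)).Finite := by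
  classical
  obtain ⟨n, hn⟩ := Φ.exists_level
  haveI : NeZero (p ^ n) := ⟨pow_ne_zero n (Fact.out : p.Prime).ne_zero⟩
  refine (Set.finite_range (fun t : ZMod (p ^ n) ↦ Φ ((t.val : ℕ) : ℤ_[p]))).subset ?_
  rintro _ ⟨x, rfl⟩
  refine ⟨PadicInt.toZModPow n x, hn _ _ ?_⟩
  rw [← PadicInt.ker_toZModPow, RingHom.mem_ker, map_sub, map_natCast, ZMod.natCast_zmod_val,
    sub_self]

/-- **`L_*` is surjective for a surjective `L : A → A'` out of a `p`-primary `A`**: lift the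
finitely many values of a smooth function along `L`; the lifts are uniformly `p`-power torsion
(exactness of `· ⊗ Λ^∨` on `p`-primary modules, right end).
[cite: PollackWeston2011, Lemma 3.2 (ℋ_ℓ = H¹(K_ℓ, A_f) ⊗ Λ^∨, functorial in the coefficients)] -/
theorem mapRange_surjective_of_surjective {L : A →ₗ[𝒪] A'} (hL : Function.Surjective L)
    (hA : ∀ a : A, ∃ k : ℕ, p ^ k • a = 0) : Function.Surjective (mapRange (p := p) L) := by
  intro Φ'
  choose s hs using hL
  obtain ⟨n, hn⟩ := Φ'.exists_level
  have hfin : (Set.range fun x : ℤ_[p] ↦ s (Φ' x)).Finite := by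
    have : (Set.range fun x : ℤ_[p] ↦ s (Φ' x)) ⊆ s '' Set.range (Φ' : ℤ_[p] → A') := by
      rintro _ ⟨x, rfl⟩
      exact ⟨Φ' x, ⟨x, rfl⟩, rfl⟩
    exact ((finite_range Φ').image s).subset this
  obtain ⟨k, hk⟩ := exists_uniform_pow_smul_eq_zero (p := p) hfin (fun x ↦ hA _)
  refine ⟨BigRepModule.mk (fun x ↦ s (Φ' x)) ⟨⟨n, fun x y hxy ↦ by simp only [hn x y hxy]⟩, ⟨k, hk⟩⟩,
    BigRepModule.ext fun x ↦ ?_⟩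
  rw [mapRange_apply, BigRepModule.mk_apply, hs]

/-- **`A ↦ A ⊗ Λ^*` preserves exactness at the middle term** when the first map is injective:
`0 → A' → A → A''` exact gives `L(A') → L(A) → L(A'')` exact (a function killed by `L'_*` takes
values in `ker L' = im L`, and its pointwise preimage under the injective `L` is smooth,
`mem_range_mapRange_iff`). [cite: PollackWeston2011, Lemma 3.2 (ℋ_ℓ = H¹(K_ℓ, A_f) ⊗ Λ^∨, functorial in the coefficients)] -/
theorem exact_mapRangeₗ_of_injective {L : A' →ₗ[𝒪] A} {L' : A →ₗ[𝒪] A''}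
    (hL : Function.Injective L) (h : Function.Exact L L') :
    Function.Exact (mapRangeₗ (p := p) L) (mapRangeₗ (p := p) L') := by
  intro Φ
  constructor
  · intro hΦ
    have hx : ∀ x, Φ x ∈ LinearMap.range L := fun x ↦ by
      rw [← h.linearMap_ker_eq, LinearMap.mem_ker]
      have e := DFunLike.congr_fun hΦ x
      rwa [mapRangeₗ_apply, mapRange_apply, BigRepModule.zero_apply] at e
    obtain ⟨Ψ, hΨ⟩ := (mem_range_mapRange_iff hL Φ).2 hx
    exact ⟨Ψ, hΨ⟩
  · rintro ⟨Ψ, rfl⟩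
    refine BigRepModule.ext fun x ↦ ?_
    rw [mapRangeₗ_apply, mapRangeₗ_apply, mapRange_apply, mapRange_apply, BigRepModule.zero_apply]
    exact h.apply_apply_eq_zero (Ψ x)

end Exactness

/-! ## §2 The dual `X(H) = (H ⊗ Λ^*)^∨` over `Λ = ℤ_p⟦T⟧`: separated, finitely generated, torsion -/

section Dual

variable {p : ℕ} [Fact p.Prime] {H : Type*} [AddCommGroup H] [Module ℤ_[p] H]

/-- **`X(H)` is `(p, T)`-separated**: a character of the shape `Tᵏ·y + pᵏ·z` for every `k` vanishes,
because every smooth function is killed by a power of `T` (`exists_X_pow_smul_eq_zero`) and by a power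
of `p` (`exists_C_natCast_pow_smul_eq_zero`). (Hypothesis (N1) of the tree's compact Nakayama.)
[cite: Washington1997, Lemma 13.16 (Nakayama for compact Λ-modules; X = Hom(·, ℚ_p/ℤ_p) is compact)]
[cite: GreenbergLNM1716, §4, proof of Prop. 4.10] -/
theorem characterModule_separated (x : CharacterModule (BigRepModule ℤ_[p] p H))
    (hx : ∀ k : ℕ, ∃ y z : CharacterModule (BigRepModule ℤ_[p] p H),
      (PowerSeries.X : IwasawaAlgebra p) ^ k • y + PowerSeries.C ((p : ℤ_[p]) ^ k) • z = x) :
    x = 0 := by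
  ext Φ
  obtain ⟨n, hn⟩ := exists_X_pow_smul_eq_zero Φ
  obtain ⟨k, hk⟩ := exists_C_natCast_pow_smul_eq_zero Φ
  obtain ⟨y, z, hyz⟩ := hx (max n k)
  obtain ⟨c, hc⟩ := pow_dvd_pow (PowerSeries.X : IwasawaAlgebra p) (le_max_left n k)
  obtain ⟨d, hd⟩ := pow_dvd_pow (PowerSeries.C (p : ℤ_[p]) : IwasawaAlgebra p) (le_max_right n k)
  have h1 : ((PowerSeries.X : IwasawaAlgebra p) ^ max n k) • Φ = 0 := by
    rw [hc, mul_comm, mul_smul, hn, smul_zero]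
  have h2 : (PowerSeries.C ((p : ℤ_[p]) ^ max n k) : IwasawaAlgebra p) • Φ = 0 := by
    rw [map_pow, hd, mul_comm, mul_smul, hk, smul_zero]
  have hy : (((PowerSeries.X : IwasawaAlgebra p) ^ max n k) • y) Φ = 0 := by
    rw [CharacterModule.smul_apply, h1, map_zero]
  have hz : ((PowerSeries.C ((p : ℤ_[p]) ^ max n k) : IwasawaAlgebra p) • z) Φ = 0 := by
    rw [CharacterModule.smul_apply, h2, map_zero]
  rw [← hyz]
  change (((PowerSeries.X : IwasawaAlgebra p) ^ max n k) • y) Φ +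
    ((PowerSeries.C ((p : ℤ_[p]) ^ max n k) : IwasawaAlgebra p) • z) Φ = 0
  rw [hy, hz, add_zero]

/-- **`L(H)[T]` is finite** for finite `H`: a smooth function killed by `T` is constant
(`X_smul_eq_zero_iff`), so `Φ ↦ Φ(0)` is injective on `L(H)[T]` (`𝒜[T] ≅ A`).
[cite: GreenbergLNM1716, §4, before Prop. 4.10 (𝒜[θ] ≅ Hom(Λ/Λθ, E[p^∞]))] -/
theorem finite_torsionBy_X [Finite H] :
    Finite (Submodule.torsionBy (IwasawaAlgebra p) (BigRepModule ℤ_[p] p H)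
      (PowerSeries.X : IwasawaAlgebra p)) := by
  refine Finite.of_injective (fun Φ : Submodule.torsionBy (IwasawaAlgebra p) (BigRepModule ℤ_[p] p H)
      (PowerSeries.X : IwasawaAlgebra p) ↦ (Φ : BigRepModule ℤ_[p] p H) 0) fun Φ Ψ hΦΨ ↦ ?_
  have hΦ := (X_smul_eq_zero_iff (Φ : BigRepModule ℤ_[p] p H)).1
    ((Submodule.mem_torsionBy_iff _ _).1 Φ.2)
  have hΨ := (X_smul_eq_zero_iff (Ψ : BigRepModule ℤ_[p] p H)).1
    ((Submodule.mem_torsionBy_iff _ _).1 Ψ.2)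
  refine Subtype.ext (BigRepModule.ext fun x ↦ ?_)
  rw [hΦ x, hΨ x]
  exact hΦΨ

/-- The cardinality of `L(H)[T]` is `#H` when `H` is `p`-primary (then every constant function is
smooth `p`-primary: `Φ ↦ Φ(0)` is a bijection `L(H)[T] ≃ H`).
[cite: GreenbergLNM1716, §4, before Prop. 4.10 (𝒜[θ] ≅ Hom(Λ/Λθ, E[p^∞]); θ = T)] -/
theorem natCard_torsionBy_X (hH : ∀ h : H, ∃ k : ℕ, p ^ k • h = 0) :
    Nat.card (Submodule.torsionBy (IwasawaAlgebra p) (BigRepModule ℤ_[p] p H)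
      (PowerSeries.X : IwasawaAlgebra p)) = Nat.card H := by
  refine Nat.card_eq_of_bijective (fun Φ : Submodule.torsionBy (IwasawaAlgebra p)
      (BigRepModule ℤ_[p] p H) (PowerSeries.X : IwasawaAlgebra p) ↦ (Φ : BigRepModule ℤ_[p] p H) 0)
    ⟨fun Φ Ψ hΦΨ ↦ ?_, fun a ↦ ?_⟩
  · have hΦ := (X_smul_eq_zero_iff (Φ : BigRepModule ℤ_[p] p H)).1
      ((Submodule.mem_torsionBy_iff _ _).1 Φ.2)
    have hΨ := (X_smul_eq_zero_iff (Ψ : BigRepModule ℤ_[p] p H)).1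
      ((Submodule.mem_torsionBy_iff _ _).1 Ψ.2)
    refine Subtype.ext (BigRepModule.ext fun x ↦ ?_)
    rw [hΦ x, hΨ x]
    exact hΦΨ
  · refine ⟨⟨BigRepModule.mk (fun _ : ℤ_[p] ↦ a) ((const_mem_bigRepSubmodule_iff a).2 (hH a)),
      (Submodule.mem_torsionBy_iff _ _).2 ((X_smul_eq_zero_iff _).2 fun x ↦ rfl)⟩, rfl⟩

/-- **`X(H) = (H ⊗ Λ^*)^∨` is a finitely generated `Λ`-module** for finite `H` — the tree's compact
Nakayama in separated form: (N1) `characterModule_separated`; (N2) `X = ⟨s⟩_Λ + T·X` for a finite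
`s` of representatives of the finitely many restrictions `X → (L(H)[T])^∨` (a character killing
`L(H)[T]` is a `T`-multiple: factor through `L/L[T] ≅ T·L ↪ L` and extend, `ℚ/ℤ` injective —
`SkinnerUrban2014.exists_smul_eq_of_forall_apply_eq_zero`).
[cite: Washington1997, Lemma 13.16] [cite: GreenbergLNM1716, §4, Props. 4.9–4.10]
[cite: Castella2018, Def. 2.2 (p. 4, "easily shown to be a finitely generated Λ-module")] -/
theorem module_finite_characterModule [Finite H] :
    Module.Finite (IwasawaAlgebra p) (CharacterModule (BigRepModule ℤ_[p] p H)) := by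
  classical
  set C : Submodule (IwasawaAlgebra p) (BigRepModule ℤ_[p] p H) :=
    Submodule.torsionBy (IwasawaAlgebra p) (BigRepModule ℤ_[p] p H) (PowerSeries.X : IwasawaAlgebra p)
    with hC
  haveI : Finite C := finite_torsionBy_X
  haveI : Finite (CharacterModule C) := SkinnerUrban2014.finite_characterModule C
  let res : CharacterModule (BigRepModule ℤ_[p] p H) →ₗ[IwasawaAlgebra p] CharacterModule C :=
    CharacterModule.dual C.subtype
  set R : Set (CharacterModule C) := Set.range res with hR
  have hxR : ∀ x, res x ∈ R := fun x ↦ hR ▸ Set.mem_range_self x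
  haveI : Finite R := hR ▸ inferInstance
  letI : Fintype R := Fintype.ofFinite R
  choose rep hrep using fun r : R ↦ (show (r : CharacterModule C) ∈ Set.range res from hR ▸ r.2)
  refine module_finite_of_separated_of_forall_exists_sub_X_smul_mem_span
    (fun x hx ↦ characterModule_separated x hx) (Finset.univ.image rep) fun x ↦ ?_
  have hkill : ∀ Φ : BigRepModule ℤ_[p] p H, (PowerSeries.X : IwasawaAlgebra p) • Φ = 0 →
      (x - rep ⟨res x, hxR x⟩) Φ = 0 := by
    intro Φ hΦ
    have e := DFunLike.congr_fun (hrep ⟨res x, hxR x⟩) ⟨Φ, (Submodule.mem_torsionBy_iff _ _).2 hΦ⟩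
    change rep ⟨res x, hxR x⟩ Φ = x Φ at e
    change x Φ - rep ⟨res x, hxR x⟩ Φ = 0
    rw [e, sub_self]
  obtain ⟨y, hy⟩ := SkinnerUrban2014.exists_smul_eq_of_forall_apply_eq_zero
    (PowerSeries.X : IwasawaAlgebra p) _ hkill
  refine ⟨y, ?_⟩
  rw [hy, sub_sub_cancel]
  exact Submodule.subset_span (Finset.mem_coe.2 (Finset.mem_image_of_mem rep (Finset.mem_univ _)))

omit [Fact p.Prime] [Module ℤ_[p] H] in
/-- A FINITE `p`-primary module is killed by ONE power of `p`. [folklore] -/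
private theorem exists_pow_smul_eq_zero_of_finite [Finite H] (hH : ∀ h : H, ∃ k : ℕ, p ^ k • h = 0) :
    ∃ k : ℕ, ∀ h : H, p ^ k • h = 0 := by
  obtain ⟨k, hk⟩ := exists_uniform_pow_smul_eq_zero (p := p) (Φ := (id : H → H)) (Set.finite_univ.subset
    (Set.subset_univ _)) (fun h ↦ hH h)
  exact ⟨k, hk⟩

/-- `(p : Λ)^k ≠ 0` (`Λ = ℤ_p⟦T⟧` is a domain of characteristic `0`). [folklore] -/
private theorem natCast_prime_pow_ne_zero (k : ℕ) : ((p : IwasawaAlgebra p) ^ k) ≠ 0 := by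
  refine pow_ne_zero k ?_
  rw [← map_natCast (PowerSeries.C : ℤ_[p] →+* IwasawaAlgebra p)]
  exact (map_ne_zero_iff _ PowerSeries.C_injective).2 (Nat.cast_ne_zero.2 (Fact.out : p.Prime).ne_zero)

/-- **`X(H)` is `Λ`-torsion** for a finite `p`-primary `H`: `p^k` kills `H`, hence every smooth
`H`-valued function (`smul_eq_zero_iff_forall`), hence every character. [cite: Castella2018, Thm. 2.3 (2.7) (the finite factor #H¹(K_w, E[p^∞]))]
[cite: PollackWeston2011, Lemma 3.2] -/
theorem isTorsion_characterModule [Finite H] (hH : ∀ h : H, ∃ k : ℕ, p ^ k • h = 0) :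
    Module.IsTorsion (IwasawaAlgebra p) (CharacterModule (BigRepModule ℤ_[p] p H)) := by
  obtain ⟨k, hk⟩ := exists_pow_smul_eq_zero_of_finite hH
  intro x
  refine ⟨⟨(p : IwasawaAlgebra p) ^ k, mem_nonZeroDivisors_of_ne_zero (natCast_prime_pow_ne_zero k)⟩,
    ?_⟩
  change ((p : IwasawaAlgebra p) ^ k) • x = 0
  ext Φ
  have hΦ : ((p : IwasawaAlgebra p) ^ k) • Φ = 0 := by
    rw [← Nat.cast_pow, ← map_natCast (PowerSeries.C : ℤ_[p] →+* IwasawaAlgebra p), C_smul,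
      Nat.cast_smul_eq_nsmul]
    refine BigRepModule.ext fun x ↦ ?_
    rw [BigRepModule.nsmul_apply, hk, BigRepModule.zero_apply]
  rw [CharacterModule.smul_apply, hΦ, map_zero]
  rfl

/-- `p`, hence `(p : Λ)`, kills `X(H)` when `p` kills `H`. [cite: Castella2018, Thm. 2.3 (2.7)] -/
theorem natCast_prime_smul_characterModule_eq_zero (hpH : ∀ h : H, p • h = 0)
    (x : CharacterModule (BigRepModule ℤ_[p] p H)) : (p : IwasawaAlgebra p) • x = 0 := by
  ext Φ
  have hΦ : (p : IwasawaAlgebra p) • Φ = 0 := by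
    rw [← map_natCast (PowerSeries.C : ℤ_[p] →+* IwasawaAlgebra p), C_smul, Nat.cast_smul_eq_nsmul]
    refine BigRepModule.ext fun x ↦ ?_
    rw [BigRepModule.nsmul_apply, hpH, BigRepModule.zero_apply]
  rw [CharacterModule.smul_apply, hΦ, map_zero]
  rfl

end Dual

/-! ## §3 The cyclic case `#H = p`: `X(H)` is a quotient of `Λ/(p)`, so `(p) ⊆ Ch(X(H))` -/

section PrimeOrder

variable {p : ℕ} [Fact p.Prime]

/-- **The `p`-torsion of `ℚ/ℤ` is generated by any of its non-zero elements**: the subgroup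
`ℤ·u₀` of a non-zero `p`-torsion `u₀` has `p` elements (`addOrderOf u₀ = p`), the `p`-torsion has at
most `p` (`AddCircle.card_torsion_le_of_isSMulRegular`), so they coincide. [folklore] -/
private theorem AddCircle.mem_zmultiples_of_prime_nsmul_eq_zero {u₀ u : AddCircle (1 : ℚ)}
    (h₀ : p • u₀ = 0) (hne : u₀ ≠ 0) (hu : p • u = 0) : u ∈ AddSubgroup.zmultiples u₀ := by
  have hp := (Fact.out : p.Prime)
  set T : Set (AddCircle (1 : ℚ)) := {x | p • x = 0} with hT
  have hTfin : T.Finite := AddCircle.finite_torsion (1 : ℚ) hp.pos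
  have hreg : IsSMulRegular ℚ p := fun x y hxy ↦ by
    simp only [nsmul_eq_mul] at hxy
    exact mul_left_cancel₀ (Nat.cast_ne_zero.2 hp.ne_zero) hxy
  have hTcard : T.encard ≤ p := AddCircle.card_torsion_le_of_isSMulRegular (1 : ℚ) p hp.ne_zero hreg
  have hsub : (AddSubgroup.zmultiples u₀ : Set (AddCircle (1 : ℚ))) ⊆ T := by
    rintro _ ⟨z, rfl⟩
    change p • (z • u₀) = 0
    rw [← natCast_zsmul, smul_smul, mul_comm, ← smul_smul, natCast_zsmul, h₀, smul_zero]
  have hSfin : (AddSubgroup.zmultiples u₀ : Set (AddCircle (1 : ℚ))).Finite := hTfin.subset hsub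
  have hScard : (AddSubgroup.zmultiples u₀ : Set (AddCircle (1 : ℚ))).encard = p := by
    have h1 : Nat.card (AddSubgroup.zmultiples u₀) = p := by
      rw [Nat.card_zmultiples, addOrderOf_eq_prime h₀ hne]
    rw [← hSfin.cast_ncard_eq, ← Nat.card_coe_set_eq]
    exact congrArg _ h1
  have hST : (AddSubgroup.zmultiples u₀ : Set (AddCircle (1 : ℚ))) = T :=
    hSfin.eq_of_subset_of_encard_le hsub (hScard ▸ hTcard)
  have huT : u ∈ T := hu
  rw [← hST] at huT
  exact huT

/-- **Characters of a group of prime order**: every character is an integer multiple of any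
injective one (pointwise), because the group is cyclic on any non-zero element
(`zmultiples_eq_top_of_prime_card`) and the `p`-torsion of `ℚ/ℤ` is cyclic on the value there
(`AddCircle.mem_zmultiples_of_prime_nsmul_eq_zero`). [folklore] -/
private theorem exists_apply_eq_zsmul_of_card_eq_prime {C : Type*} [AddCommGroup C] (hC : Nat.card C = p)
    (χ₀ : CharacterModule C) (hχ₀ : Function.Injective χ₀) (χ : CharacterModule C) :
    ∃ z : ℤ, ∀ c : C, χ c = z • χ₀ c := by
  have hp := (Fact.out : p.Prime)
  haveI : Finite C := Nat.finite_of_card_ne_zero (by rw [hC]; exact hp.ne_zero)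
  obtain ⟨g, hg⟩ : ∃ g : C, g ≠ 0 := by
    by_contra! h
    haveI : Subsingleton C := ⟨fun a b ↦ by rw [h a, h b]⟩
    have h1 : Nat.card C = 1 := Nat.card_of_subsingleton (0 : C)
    exact hp.one_lt.ne' (hC ▸ h1)
  have htop : AddSubgroup.zmultiples g = ⊤ := zmultiples_eq_top_of_prime_card hC hg
  have hpg : p • g = 0 := by
    rw [← hC]
    exact addOrderOf_dvd_iff_nsmul_eq_zero.1 (addOrderOf_dvd_natCard g)
  have h₀ : p • χ₀ g = 0 := by rw [← map_nsmul, hpg, map_zero]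
  have hne : χ₀ g ≠ 0 := fun h ↦ hg (hχ₀ (by rw [h, map_zero]))
  have hu : p • χ g = 0 := by rw [← map_nsmul, hpg, map_zero]
  obtain ⟨z, hz⟩ := AddSubgroup.mem_zmultiples_iff.1
    (AddCircle.mem_zmultiples_of_prime_nsmul_eq_zero h₀ hne hu)
  refine ⟨z, fun c ↦ ?_⟩
  obtain ⟨m, rfl⟩ := AddSubgroup.mem_zmultiples_iff.1 (htop ▸ AddSubgroup.mem_top c)
  rw [map_zsmul, map_zsmul, ← hz, smul_comm]

variable {H : Type*} [AddCommGroup H] [Module ℤ_[p] H]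

/-- **For `#H = p` the dual `X(H)` is a CYCLIC `Λ`-module**, generated by `x₀ = χ₀ ∘ ev₀` for any
injective character `χ₀` of `H`: by compact Nakayama (`characterModule_separated`) it suffices that
`X = Λ·x₀ + T·X`; the restriction of `x ∈ X` to the constants `L(H)[T] ≃ H` (a group of order `p`)
is an integer multiple `z·(x₀|)` (`exists_apply_eq_zsmul_of_card_eq_prime`), and `x − z·x₀`, killing
`L(H)[T]`, is a `T`-multiple (factor and extend). (`(ℤ/p ⊗ Λ^∨)^∨ ≅ Λ/p`.)
[cite: Washington1997, Lemma 13.16] [cite: GreenbergLNM1716, §4, Props. 4.9–4.10]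
[cite: PollackWeston2011, Lemma 3.2] -/
theorem exists_span_singleton_eq_top_of_card_eq_prime (hcard : Nat.card H = p) :
    ∃ x₀ : CharacterModule (BigRepModule ℤ_[p] p H),
      Submodule.span (IwasawaAlgebra p) {x₀} = ⊤ := by
  classical
  have hp := (Fact.out : p.Prime)
  haveI : Finite H := Nat.finite_of_card_ne_zero (by rw [hcard]; exact hp.ne_zero)
  haveI : Fact (Nat.card H).Prime := ⟨by rw [hcard]; exact hp⟩
  have hpH : ∀ h : H, p • h = 0 := fun h ↦ by
    rw [← hcard]
    exact addOrderOf_dvd_iff_nsmul_eq_zero.1 (addOrderOf_dvd_natCard h)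
  have hH : ∀ h : H, ∃ k : ℕ, p ^ k • h = 0 := fun h ↦ ⟨1, by rw [pow_one]; exact hpH h⟩
  -- an injective character `χ₀` of `H`
  obtain ⟨g, hg⟩ : ∃ g : H, g ≠ 0 := by
    by_contra! h
    haveI : Subsingleton H := ⟨fun a b ↦ by rw [h a, h b]⟩
    have h1 : Nat.card H = 1 := Nat.card_of_subsingleton (0 : H)
    exact hp.one_lt.ne' (hcard ▸ h1)
  obtain ⟨χ₀, hχ₀g⟩ := CharacterModule.exists_character_apply_ne_zero_of_ne_zero hg
  have hχ₀ : Function.Injective χ₀ := by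
    rcases ((χ₀ : H →+ AddCircle (1 : ℚ)).ker).eq_bot_or_eq_top_of_prime_card with h | h
    · exact (AddMonoidHom.ker_eq_bot_iff _).1 h
    · exact absurd ((AddMonoidHom.mem_ker).1 (h ▸ AddSubgroup.mem_top g)) hχ₀g
  -- `x₀ = χ₀ ∘ ev₀`
  let ev₀ : BigRepModule ℤ_[p] p H →+ H :=
    { toFun := fun Φ ↦ Φ 0, map_zero' := rfl, map_add' := fun _ _ ↦ rfl }
  let x₀ : CharacterModule (BigRepModule ℤ_[p] p H) := (χ₀ : H →+ AddCircle (1 : ℚ)).comp ev₀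
  have hx₀ : ∀ Φ : BigRepModule ℤ_[p] p H, x₀ Φ = χ₀ (Φ 0) := fun _ ↦ rfl
  refine ⟨x₀, ?_⟩
  rw [← Finset.coe_singleton]
  refine span_eq_top_of_separated_of_forall_exists_sub_X_smul_mem_span
    (fun x hx ↦ characterModule_separated x hx) {x₀} fun x ↦ ?_
  -- the constants `C = L(H)[T]`, a group of order `p`
  set C : Submodule (IwasawaAlgebra p) (BigRepModule ℤ_[p] p H) :=
    Submodule.torsionBy (IwasawaAlgebra p) (BigRepModule ℤ_[p] p H) (PowerSeries.X : IwasawaAlgebra p)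
    with hCdef
  have hC : Nat.card C = p := (natCard_torsionBy_X hH).trans hcard
  have hconst : ∀ Φ : C, ∀ y, (Φ : BigRepModule ℤ_[p] p H) y = (Φ : BigRepModule ℤ_[p] p H) 0 :=
    fun Φ ↦ (X_smul_eq_zero_iff (Φ : BigRepModule ℤ_[p] p H)).1 ((Submodule.mem_torsionBy_iff _ _).1 Φ.2)
  let r : CharacterModule (BigRepModule ℤ_[p] p H) → CharacterModule C :=
    fun y ↦ (y : BigRepModule ℤ_[p] p H →+ AddCircle (1 : ℚ)).comp C.subtype.toAddMonoidHom
  have hr : ∀ (y : CharacterModule (BigRepModule ℤ_[p] p H)) (Φ : C),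
      r y Φ = y (Φ : BigRepModule ℤ_[p] p H) := fun _ _ ↦ rfl
  have hr₀ : Function.Injective (r x₀) := by
    intro Φ Ψ hΦΨ
    rw [hr, hr, hx₀, hx₀] at hΦΨ
    have h0 := hχ₀ hΦΨ
    refine Subtype.ext (BigRepModule.ext fun y ↦ ?_)
    rw [hconst Φ y, hconst Ψ y, h0]
  obtain ⟨z, hz⟩ := exists_apply_eq_zsmul_of_card_eq_prime hC (r x₀) hr₀ (r x)
  -- `x − z·x₀` kills the constants, hence is a `T`-multiple
  have hkill : ∀ Φ : BigRepModule ℤ_[p] p H, (PowerSeries.X : IwasawaAlgebra p) • Φ = 0 →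
      (x - ((z : ℤ) : IwasawaAlgebra p) • x₀) Φ = 0 := by
    intro Φ hΦ
    have e := hz ⟨Φ, (Submodule.mem_torsionBy_iff _ _).2 hΦ⟩
    rw [hr, hr] at e
    change x Φ - (((z : ℤ) : IwasawaAlgebra p) • x₀) Φ = 0
    rw [CharacterModule.smul_apply, Int.cast_smul_eq_zsmul, map_zsmul, ← e, sub_self]
  obtain ⟨y, hy⟩ := SkinnerUrban2014.exists_smul_eq_of_forall_apply_eq_zero
    (PowerSeries.X : IwasawaAlgebra p) _ hkill
  refine ⟨y, ?_⟩
  rw [hy, sub_sub_cancel, Finset.coe_singleton]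
  exact Submodule.smul_mem _ _ (Submodule.mem_span_singleton_self x₀)

/-- **`(p) ⊆ Ch_Λ(X(H))` for `#H = p`**: `X(H)` is cyclic (`exists_span_singleton_eq_top_of_card_eq_prime`)
and killed by `p`, hence a quotient of `Λ/(p)`, whose characteristic ideal is `(p)`
(`Module.charIdeal_quotient_span_singleton`); multiplicativity of `Ch` on
`0 → ker → Λ/(p) → X(H) → 0` (`Module.charIdeal_eq_mul_of_exact`). (`Ch((ℤ/p ⊗ Λ^∨)^∨) = (p)`.)
[cite: PollackWeston2011, Lemma 3.2] [cite: Castella2018, Thm. 2.3 (2.7)] [cite: Washington1997, §13.2] -/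
theorem natCast_prime_mem_charIdeal_of_card_eq_prime (hcard : Nat.card H = p) :
    (p : IwasawaAlgebra p) ∈
      Module.charIdeal (IwasawaAlgebra p) (CharacterModule (BigRepModule ℤ_[p] p H)) := by
  classical
  have hp := (Fact.out : p.Prime)
  haveI : Finite H := Nat.finite_of_card_ne_zero (by rw [hcard]; exact hp.ne_zero)
  have hpH : ∀ h : H, p • h = 0 := fun h ↦ by
    rw [← hcard]
    exact addOrderOf_dvd_iff_nsmul_eq_zero.1 (addOrderOf_dvd_natCard h)
  obtain ⟨x₀, hx₀⟩ := exists_span_singleton_eq_top_of_card_eq_prime hcard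
  have hp0 : (p : IwasawaAlgebra p) ≠ 0 := by
    have h := natCast_prime_pow_ne_zero (p := p) 1
    rwa [pow_one] at h
  -- the surjection `π : Λ/(p) → X(H)`, `1 ↦ x₀`
  set I : Ideal (IwasawaAlgebra p) := Ideal.span {(p : IwasawaAlgebra p)} with hI
  let φ : IwasawaAlgebra p →ₗ[IwasawaAlgebra p] CharacterModule (BigRepModule ℤ_[p] p H) :=
    LinearMap.toSpanSingleton (IwasawaAlgebra p) _ x₀
  have hIφ : (I : Submodule (IwasawaAlgebra p) (IwasawaAlgebra p)) ≤ LinearMap.ker φ := by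
    rw [hI, Ideal.span_le]
    rintro _ rfl
    rw [SetLike.mem_coe, LinearMap.mem_ker, LinearMap.toSpanSingleton_apply]
    exact natCast_prime_smul_characterModule_eq_zero hpH x₀
  let π : (IwasawaAlgebra p ⧸ I) →ₗ[IwasawaAlgebra p] CharacterModule (BigRepModule ℤ_[p] p H) :=
    Submodule.liftQ I φ hIφ
  have hπ : Function.Surjective π := by
    intro x
    have hx : x ∈ Submodule.span (IwasawaAlgebra p) {x₀} := hx₀ ▸ Submodule.mem_top
    obtain ⟨f, rfl⟩ := Submodule.mem_span_singleton.1 hx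
    exact ⟨Submodule.Quotient.mk f, by rw [Submodule.liftQ_apply, LinearMap.toSpanSingleton_apply]⟩
  -- `Λ/(p)` is finitely generated torsion with `Ch = (p)`
  have htors : Module.IsTorsion (IwasawaAlgebra p) (IwasawaAlgebra p ⧸ I) := by
    intro y
    refine ⟨⟨(p : IwasawaAlgebra p), mem_nonZeroDivisors_of_ne_zero hp0⟩, ?_⟩
    obtain ⟨f, rfl⟩ := Submodule.Quotient.mk_surjective I y
    change (p : IwasawaAlgebra p) • (Submodule.Quotient.mk f : IwasawaAlgebra p ⧸ I) = 0
    rw [← Submodule.Quotient.mk_smul, Submodule.Quotient.mk_eq_zero, hI, smul_eq_mul]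
    exact Ideal.mul_mem_right _ _ (Ideal.subset_span rfl)
  have hmul := Module.charIdeal_eq_mul_of_exact htors (LinearMap.ker π).subtype π
    (Submodule.injective_subtype _) hπ (LinearMap.exact_subtype_ker_map π)
  have hquot : Module.charIdeal (IwasawaAlgebra p) (IwasawaAlgebra p ⧸ I) = I :=
    Module.charIdeal_quotient_span_singleton hp0
  have hle : I ≤ Module.charIdeal (IwasawaAlgebra p) (CharacterModule (BigRepModule ℤ_[p] p H)) := by
    rw [← hquot, hmul]
    exact Ideal.mul_le_left
  exact hle (Ideal.subset_span rfl)

end PrimeOrder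

/-! ## §4 `#H ∈ Ch_Λ(X(H))` for every finite `p`-primary `H` (induction on `#H`) -/

section Induction

universe v

variable {p : ℕ} [Fact p.Prime]

omit [Fact p.Prime] in
/-- A non-zero `p`-primary element has a non-zero multiple killed by `p`. [folklore] -/
private theorem exists_ne_zero_prime_smul_eq_zero {H : Type v} [AddCommGroup H] {h₁ : H} (hh₁ : h₁ ≠ 0)
    (hk : ∃ k : ℕ, p ^ k • h₁ = 0) : ∃ h : H, h ≠ 0 ∧ p • h = 0 := by
  classical
  have hm : p ^ Nat.find hk • h₁ = 0 := Nat.find_spec hk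
  have hm0 : Nat.find hk ≠ 0 := fun h0 ↦ hh₁ (by rwa [h0, pow_zero, one_smul] at hm)
  refine ⟨p ^ (Nat.find hk - 1) • h₁, Nat.find_min hk (Nat.sub_lt (Nat.pos_of_ne_zero hm0) one_pos), ?_⟩
  rw [smul_smul, ← pow_succ', Nat.sub_add_cancel (Nat.pos_of_ne_zero hm0), hm]

/-- The `ℤ_p`-span of an element of order `p` has `p` elements (`ℤ_p·h = ℤ·h`, as `c·h` only depends
on `c mod p`). [folklore] -/
private theorem natCard_span_singleton_eq_prime {H : Type v} [AddCommGroup H] [Module ℤ_[p] H] {h : H}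
    (hh : h ≠ 0) (hph : p • h = 0) : Nat.card (Submodule.span ℤ_[p] ({h} : Set H)) = p := by
  have key : (Submodule.span ℤ_[p] ({h} : Set H)).toAddSubgroup = AddSubgroup.zmultiples h := by
    refine le_antisymm ?_ ?_
    · intro x hx
      rw [Submodule.mem_toAddSubgroup, Submodule.mem_span_singleton] at hx
      obtain ⟨c, rfl⟩ := hx
      -- `c ≡ c.appr 1 (mod p)`, and `p` kills `h`
      obtain ⟨d, hd⟩ := Ideal.mem_span_singleton'.1 (PadicInt.appr_spec 1 c)
      set a : ℕ := c.appr 1 with ha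
      have e : c = (a : ℤ_[p]) + d * (p : ℤ_[p]) ^ 1 := by rw [hd]; ring
      have hc : c • h = a • h := by
        have e' : c • h = ((a : ℤ_[p]) + d * (p : ℤ_[p]) ^ 1) • h := congrArg (· • h) e
        rw [e', add_smul, Nat.cast_smul_eq_nsmul, pow_one, mul_smul, Nat.cast_smul_eq_nsmul, hph,
          smul_zero, add_zero]
      rw [hc]
      exact (AddSubgroup.zmultiples h).nsmul_mem (AddSubgroup.mem_zmultiples h) _
    · rw [AddSubgroup.zmultiples_le, Submodule.mem_toAddSubgroup]
      exact Submodule.mem_span_singleton_self h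
  change Nat.card (Submodule.span ℤ_[p] ({h} : Set H)).toAddSubgroup = p
  rw [key, Nat.card_zmultiples, addOrderOf_eq_prime hph hh]

/-- **`#H ∈ Ch_Λ(X(H))` for every FINITE `p`-primary `ℤ_p`-module `H`** (`Ch((H ⊗ Λ^∨)^∨) ⊇ (#H)`;
the printed statement is the equality `Ch = (#H)`, of which this is the half the `Σ`-change uses).
Induction on `#H`: `#H = 1` — `X(H) = 0` is pseudo-null, `Ch = Λ`; else pick `h ≠ 0` with `p·h = 0`,
`H' = ℤ_p·h` of order `p`, and apply the tree's one-step lemma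
`Module.isTorsion_and_charIdeal_mul_span_le_of_exact_dual` to `0 → L(H') → L(H) → L(H/H')`
(`exact_mapRangeₗ_of_injective`): `Ch(X(H)) ⊇ Ch(X(H'))·(#(H/H')) ∋ p·#(H/H') = #H`
(`natCast_prime_mem_charIdeal_of_card_eq_prime` and the induction hypothesis).
[cite: PollackWeston2011, Lemma 3.2] [cite: Castella2018, Thm. 2.3 (2.7) (the factor ∏_{w∈Σ} #H¹(K_w, E[p^∞]))]
[cite: GreenbergVatsal2000, Prop. 2.4 (the analogous local computation)] -/
theorem natCard_mem_charIdeal_characterModule {H : Type v} [AddCommGroup H] [Module ℤ_[p] H]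
    [Finite H] (hH : ∀ h : H, ∃ k : ℕ, p ^ k • h = 0) :
    ((Nat.card H : ℕ) : IwasawaAlgebra p) ∈
      Module.charIdeal (IwasawaAlgebra p) (CharacterModule (BigRepModule ℤ_[p] p H)) := by
  classical
  have hp := (Fact.out : p.Prime)
  suffices key : ∀ (n : ℕ) (G : Type v) [AddCommGroup G] [Module ℤ_[p] G] [Finite G],
      (∀ g : G, ∃ k : ℕ, p ^ k • g = 0) → Nat.card G = n →
      ((n : ℕ) : IwasawaAlgebra p) ∈
        Module.charIdeal (IwasawaAlgebra p) (CharacterModule (BigRepModule ℤ_[p] p G)) from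
    key _ H hH rfl
  intro n
  induction n using Nat.strong_induction_on with
  | _ n ih =>
  intro G _ _ _ hG hn
  by_cases htriv : ∀ g : G, g = 0
  · -- `G = 0`: `X(G) = 0` has characteristic ideal `Λ`
    haveI : Subsingleton G := ⟨fun a b ↦ by rw [htriv a, htriv b]⟩
    haveI : Subsingleton (CharacterModule (BigRepModule ℤ_[p] p G)) := ⟨fun x y ↦ by
      ext Φ
      have hΦ : Φ = 0 := BigRepModule.ext fun t ↦ Subsingleton.elim _ _
      rw [hΦ, map_zero, map_zero]⟩
    rw [Module.charIdeal_eq_top_of_isPseudoNull (Module.isPseudoNull_of_subsingleton _ _)]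
    exact Submodule.mem_top
  · push Not at htriv
    obtain ⟨g₁, hg₁⟩ := htriv
    obtain ⟨h, hh, hph⟩ := exists_ne_zero_prime_smul_eq_zero hg₁ (hG g₁)
    -- `H' = ℤ_p·h` of order `p`, `H'' = G/H'`
    set H' : Submodule ℤ_[p] G := Submodule.span ℤ_[p] {h} with hH'def
    haveI : Finite (G ⧸ H') := Finite.of_surjective _ (Submodule.mkQ_surjective H')
    have hcard' : Nat.card H' = p := natCard_span_singleton_eq_prime hh hph
    have hcard : Nat.card G = p * Nat.card (G ⧸ H') := by
      rw [Submodule.card_eq_card_quotient_mul_card H', hcard']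
    have hlt : Nat.card (G ⧸ H') < n := by
      rw [← hn, hcard]
      exact lt_mul_left (Nat.card_pos) hp.one_lt
    have hG' : ∀ g : H', ∃ k : ℕ, p ^ k • g = 0 := fun g ↦
      (hG g).imp fun k hk ↦ Subtype.ext (by rw [AddSubmonoidClass.coe_nsmul]; exact hk)
    have hG'' : ∀ g : G ⧸ H', ∃ k : ℕ, p ^ k • g = 0 := fun g ↦ by
      obtain ⟨g, rfl⟩ := Submodule.mkQ_surjective H' g
      exact (hG g).imp fun k hk ↦ by rw [← map_nsmul, hk, map_zero]
    -- the pieces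
    haveI : Module.Finite (IwasawaAlgebra p) (CharacterModule (BigRepModule ℤ_[p] p G)) :=
      module_finite_characterModule
    haveI : Module.Finite (IwasawaAlgebra p) (CharacterModule (BigRepModule ℤ_[p] p (G ⧸ H'))) :=
      module_finite_characterModule
    have htors' : Module.IsTorsion (IwasawaAlgebra p) (CharacterModule (BigRepModule ℤ_[p] p H')) :=
      isTorsion_characterModule hG'
    have htors'' : Module.IsTorsion (IwasawaAlgebra p)
        (CharacterModule (BigRepModule ℤ_[p] p (G ⧸ H'))) := isTorsion_characterModule hG''
    have hP : ((Nat.card (G ⧸ H') : ℕ) : IwasawaAlgebra p) ∈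
        Module.charIdeal (IwasawaAlgebra p) (CharacterModule (BigRepModule ℤ_[p] p (G ⧸ H'))) :=
      ih _ hlt _ hG'' rfl
    have hp' : (p : IwasawaAlgebra p) ∈
        Module.charIdeal (IwasawaAlgebra p) (CharacterModule (BigRepModule ℤ_[p] p H')) :=
      natCast_prime_mem_charIdeal_of_card_eq_prime hcard'
    -- the one-step lemma on `0 → L(H') → L(G) → L(G/H')`
    have hstep := Module.isTorsion_and_charIdeal_mul_span_le_of_exact_dual
      (mapRangeₗ (p := p) H'.subtype) (fun Φ Ψ e ↦ mapRange_injective H'.injective_subtype e)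
      (mapRangeₗ (p := p) H'.mkQ)
      (exact_mapRangeₗ_of_injective H'.injective_subtype (LinearMap.exact_subtype_mkQ H'))
      htors' htors'' hP
    rw [← hn, hcard, Nat.cast_mul]
    exact hstep.2 (Ideal.mul_mem_mul hp' (Ideal.mem_span_singleton_self _))

/-- **The three conjuncts in the shape of the local fact**: for a finite `p`-primary `ℤ_p`-module `H`,
the Pontryagin dual `X(H)` of `H ⊗ Λ^*` is a finitely generated torsion `Λ`-module and
`#H ∈ Ch_Λ(X(H))` ([PollackWeston2011] Lemma 3.2 / [Castella2018] (2.7) in the tree's co-induced model;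
with `H = H¹(K_w, E[p^∞])` and Shapiro this is the totally split case of the local term of the
`Σ`-change). [cite: PollackWeston2011, Lemma 3.2] [cite: Castella2018, Thm. 2.3 (2.7)] -/
theorem moduleFinite_isTorsion_natCard_mem_charIdeal {H : Type v} [AddCommGroup H] [Module ℤ_[p] H]
    [Finite H] (hH : ∀ h : H, ∃ k : ℕ, p ^ k • h = 0) :
    Module.Finite (IwasawaAlgebra p) (CharacterModule (BigRepModule ℤ_[p] p H)) ∧
      Module.IsTorsion (IwasawaAlgebra p) (CharacterModule (BigRepModule ℤ_[p] p H)) ∧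
        ((Nat.card H : ℕ) : IwasawaAlgebra p) ∈
          Module.charIdeal (IwasawaAlgebra p) (CharacterModule (BigRepModule ℤ_[p] p H)) :=
  ⟨module_finite_characterModule, isTorsion_characterModule hH,
    natCard_mem_charIdeal_characterModule hH⟩

end Induction

end Literature.NumberTheory.EllipticCurves.BigRepModule

end
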